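import Literature.Probability.LatticeModels.DoubleCurrentsInfinite
import Literature.Probability.LatticeModels.CurrentsTraceLaw
import Literature.Probability.Process.KolmogorovExtensionProofs
import Literature.Probability.Percolation.RussoFormula
import HarnessLib

/-!
# ADS15 Thm. 2.3 (R1): existence of the infinite-volume double random current — proof

Trunk G02 (T-STATMECH), topic `Probability/LatticeModels`; namespaces `Literature.StatMech` (construction)
and `Literature.CritIsing` (the discharge). This file **discharges the named fact
`Literature.Probability.LatticeModels.ads_doubleCurrent_limit_exists`** (`DoubleCurrentsInfinite.lean`), i.e. ADS15
Thm. 2.3 (R1) for the double current of the nearest-neighbour model: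

* M. Aizenman, H. Duminil-Copin, V. Sidoravicius, *Random currents and continuity of Ising
  model's spontaneous magnetization*, Comm. Math. Phys. **334** (2015) 719–742, Thm. 2.3 (R1)
  and its proof, §2.3 and proof of Lemma 2.6 (arXiv:1311.1937v3; bib key
  `AizenmanDuminilCopinSidoraviciusCMP2015`): "for a proof of convergence it suffices to establish
  convergence of the law of the parity variables … `P̂^#_{Λ_L,β}[𝒞_E] = Z^#(Λ_L∖E,β)/Z^#(Λ_L,β)
  ∏ cosh(βJ) = ⟨e^{-βK_E}⟩^# ∏ cosh(βJ)` … The convergence of the above expression follows now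
  directly from the convergence of correlation functions as `L` tends to infinity. The events
  `𝒞_E` … span (by inclusion–exclusion) the algebra of events expressible in terms of finite
  collections of the binary variables … implies the existence of `P̂^#_β`."

## The construction

`CurrentsEdgeAvoidance.lean` ((2.13)–(2.14): avoidance probabilities converge) and
`CurrentsTraceLaw.lean` (inclusion–exclusion and the product structure: `ℙ_{Λ_L,β}[ω ∩ F = U]`
converges for finite sets `F` of lattice bonds) give the limits of the finite-dimensional laws of
the open/closed bond variables. Here:

1. the limits `q(F,U) = lim_L ℙ_{Λ_L,β}[ω ∩ F = U]` for arbitrary finite `F` (non-lattice bonds are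
   never open, `adsDoubleCurrentLaw_real_congr_lattice`), their nonnegativity, normalisation
   `∑_U q(F,U) = 1` and consistency `q(J,U') = ∑_{U ∩ J = U'} q(I,U)` (`J ⊆ I`), all inherited from
   the finite volumes;
2. the **projective family** `P J = ∑_{U ⊆ J} q(J,U) δ_{χ_U}` of probability measures on
   `J → Bool` (`adsProjectiveFamily`, `isProjectiveMeasureFamily_adsProjectiveFamily`);
3. its **Kolmogorov extension** (the tree's `Literature.Probability.Process.exists_isProjectiveLimit_holds`,
   `KolmogorovExtensionProofs.lean`; `Bool` is Polish) transported to bond configurations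
   `Set (Sym2 (Site d))` along `f ↦ {e | f e}`;
4. the identification of the extension as an `IsAdsLimit d β` measure: every local event is a
   finite disjoint union of the events `{ω ∩ F = U}`.

Consequence: `ads_doubleCurrent_limit_exists_holds` (R1 discharged); with it, `m*(β_c) = 0`
(`d ≥ 3`) needs from ADS15 only R2 and Thm. 2.5 (`DoubleCurrentsPercolation.lean`).

General local-event lemmas stated here for a general index type (candidates for relocation next
to `localCylinder`, `PercolationEvents.lean`): `determinedBy_localCylinder` (a cylinder `[ω]_K` is
determined by `K`) and `pairwiseDisjoint_localCylinder` (the tree's `Russo.disjoint_localCylinder`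
packaged as `Set.PairwiseDisjoint` over `F.powerset`); and, for bond configurations of `ℤ^d`,
`measurableSet_localCylinder_coe`, `coe_mem_localCylinder_iff`, `measureReal_eq_sum_localCylinder`
(a local event's probability is the sum over its cylinders, from
`DeterminedBy.eq_biUnion_localCylinder`).

## Mathlib status

Anchors: `MeasureTheory.IsProjectiveMeasureFamily`, `MeasureTheory.IsProjectiveLimit`,
`Finset.restrict`, `Finset.restrict₂`, `Measure.map_apply`, `Measure.dirac_apply'`,
`Measure.finsetSum_apply`, `measureReal_biUnion_finset`, `Finset.sum_fiberwise_of_maps_to`,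
`tendsto_finsetSum`, `tendsto_nhds_unique`; tree: `Literature.Probability.Process.exists_isProjectiveLimit_holds`.
-/

noncomputable section

open MeasureTheory Filter Topology Finset Literature.Probability.LatticeModels Literature.Probability.Percolation
open scoped symmDiff ENNReal

namespace Literature.Probability.LatticeModels

variable (d : ℕ)

/-! ### The double current only charges lattice configurations -/

/-- Events that agree on lattice configurations have the same `ℙ_{Λ_L,β}`-probability (`β ≥ 0`). [folklore] -/
theorem adsDoubleCurrentLaw_real_congr_lattice (L : ℕ) {β : ℝ} (hβ : 0 ≤ β)
    {A B : Set (BondConfig (Site d))}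
    (h : ∀ ω : BondConfig (Site d), ω ⊆ (zdGraph d).edgeSet → (ω ∈ A ↔ ω ∈ B)) :
    (adsDoubleCurrentLaw d L β).real A = (adsDoubleCurrentLaw d L β).real B := by
  classical
  have hN := adsPairNorm_pos d L hβ
  rw [adsDoubleCurrentLaw_real_apply d L hβ hN, adsDoubleCurrentLaw_real_apply d L hβ hN]
  refine tsum_congr fun p => ?_
  have hiff := h _ (liftBonds_traced_subset_edgeSet d p)
  by_cases hA : liftBonds d L (p.1.traced ∪ p.2.traced) ∈ A
  · rw [if_pos hA, if_pos (hiff.1 hA)]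
  · rw [if_neg hA, if_neg fun hB => hA (hiff.2 hB)]

/-! ### The limits `q(F,U)` of `ℙ_{Λ_L,β}[ω ∩ F = U]` for arbitrary finite `F` -/

/-- The limit `q(F,U) = lim_L ℙ_{Λ_L,β}[ω ∩ F = U]` for an arbitrary finite set of pairs `F` and
`U ⊆ F`: zero if `U` contains a non-lattice pair, otherwise the limit of `CurrentsTraceLaw.lean` for
the lattice parts of `F` and `U`. [cite: AizenmanDuminilCopinSidoraviciusCMP2015, Thm. 2.3 (R1), proof] -/
def adsTraceLimitGen (β : ℝ) (F U : Finset (Sym2 (Site d))) : ℝ :=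
  if ∀ e ∈ F, e ∉ (zdGraph d).edgeSet → e ∉ U then
    adsTraceLimit d β (F.filter (· ∈ (zdGraph d).edgeSet)) (U.filter (· ∈ (zdGraph d).edgeSet))
  else 0

/-- **Convergence of `ℙ_{Λ_L,β}[ω ∩ F = U]` for every finite `F` and `U ⊆ F`** (`β ≥ 0`). [cite: AizenmanDuminilCopinSidoraviciusCMP2015, Thm. 2.3 (R1), proof] -/
theorem tendsto_adsDoubleCurrentLaw_localCylinder {β : ℝ} (hβ : 0 ≤ β)
    {F U : Finset (Sym2 (Site d))} (hUF : U ⊆ F) :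
    Tendsto (fun L : ℕ => (adsDoubleCurrentLaw d L β).real (localCylinder (↑F : Set (Sym2 (Site d))) ↑U)) atTop
      (𝓝 (adsTraceLimitGen d β F U)) := by
  unfold adsTraceLimitGen
  by_cases hgood : ∀ e ∈ F, e ∉ (zdGraph d).edgeSet → e ∉ U
  · rw [if_pos hgood]
    set F' := F.filter (· ∈ (zdGraph d).edgeSet) with hF'
    set U' := U.filter (· ∈ (zdGraph d).edgeSet) with hU'
    have hF'E : (↑F' : Set (Sym2 (Site d))) ⊆ (zdGraph d).edgeSet := fun e he =>
      (Finset.mem_filter.1 (Finset.mem_coe.1 he)).2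
    have hU'F' : U' ⊆ F' := Finset.filter_subset_filter _ hUF
    have heq : ∀ L, (adsDoubleCurrentLaw d L β).real (localCylinder (↑F : Set (Sym2 (Site d))) ↑U) =
        (adsDoubleCurrentLaw d L β).real (localCylinder (↑F' : Set (Sym2 (Site d))) ↑U') := by
      intro L
      refine adsDoubleCurrentLaw_real_congr_lattice d L hβ fun ω hω => ?_
      rw [mem_localCylinder_coe_iff, mem_localCylinder_coe_iff]
      constructor
      · intro h e he
        rw [hF', Finset.mem_filter] at he
        rw [hU', Finset.mem_filter, h e he.1]
        exact ⟨fun h' => h'.1, fun h' => ⟨h', he.2⟩⟩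
      · intro h e he
        by_cases heE : e ∈ (zdGraph d).edgeSet
        · have h1 := h e (by rw [hF', Finset.mem_filter]; exact ⟨he, heE⟩)
          rw [hU', Finset.mem_filter] at h1
          rw [← h1]
          exact ⟨fun h' => ⟨h', heE⟩, fun h' => h'.1⟩
        · exact ⟨fun heU => absurd heU (hgood e he heE), fun heω => absurd (hω heω) heE⟩
    simp_rw [heq]
    exact tendsto_adsDoubleCurrentLaw_traceEvent d hβ hF'E hU'F'
  · rw [if_neg hgood]
    push Not at hgood
    obtain ⟨e, heF, heE, heU⟩ := hgood
    have heq : ∀ L, (adsDoubleCurrentLaw d L β).real (localCylinder (↑F : Set (Sym2 (Site d))) ↑U) = 0 := by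
      intro L
      rw [← measureReal_empty (μ := adsDoubleCurrentLaw d L β)]
      refine adsDoubleCurrentLaw_real_congr_lattice d L hβ fun ω hω => ?_
      rw [mem_localCylinder_coe_iff, Set.mem_empty_iff_false, iff_false]
      intro h
      exact heE (hω ((h e heF).1 heU))
    simp_rw [heq]
    exact tendsto_const_nhds

/-- `q(F,U) ≥ 0`. [folklore] -/
theorem adsTraceLimitGen_nonneg {β : ℝ} (hβ : 0 ≤ β) {F U : Finset (Sym2 (Site d))} (hUF : U ⊆ F) :
    0 ≤ adsTraceLimitGen d β F U :=
  ge_of_tendsto' (tendsto_adsDoubleCurrentLaw_localCylinder d hβ hUF) fun _ => measureReal_nonneg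

/-- Cylinders on `F` are measurable. [folklore] -/
theorem measurableSet_localCylinder_coe (F : Finset (Sym2 (Site d))) (U : Set (Sym2 (Site d))) :
    MeasurableSet (localCylinder (↑F : Set (Sym2 (Site d))) U) :=
  measurableSet_localCylinder F.finite_toSet.countable U

/-- Distinct subsets of `F` define pairwise disjoint `F`-cylinders (the tree's
`Russo.disjoint_localCylinder`, packaged as `Set.PairwiseDisjoint`; general index type). [folklore] -/
theorem pairwiseDisjoint_localCylinder {ι : Type*} (F : Finset ι) :
    (↑F.powerset : Set (Finset ι)).PairwiseDisjoint
      (fun U : Finset ι => localCylinder (↑F : Set ι) (↑U : Set ι)) := fun _ hU _ hU' hne =>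
  Literature.Probability.Percolation.Russo.disjoint_localCylinder (Finset.mem_powerset.1 (Finset.mem_coe.1 hU))
    (Finset.mem_powerset.1 (Finset.mem_coe.1 hU')) hne

open Classical in
/-- The probability of a local event is the sum over its cylinders (the tree's
`DeterminedBy.eq_biUnion_localCylinder`), for any finite measure. [folklore] -/
theorem measureReal_eq_sum_localCylinder (μ : Measure (BondConfig (Site d))) [IsFiniteMeasure μ]
    {A : Set (BondConfig (Site d))} {F : Finset (Sym2 (Site d))} (hA : DeterminedBy A ↑F) :
    μ.real A = ∑ U ∈ F.powerset.filter (fun U : Finset (Sym2 (Site d)) => (↑U : Set (Sym2 (Site d))) ∈ A),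
      μ.real (localCylinder (↑F : Set (Sym2 (Site d))) ↑U) := by
  conv_lhs => rw [hA.eq_biUnion_localCylinder]
  refine measureReal_biUnion_finset ?_ (fun U _ => measurableSet_localCylinder_coe d F ↑U)
  exact (pairwiseDisjoint_localCylinder F).subset (Finset.coe_subset.2 (Finset.filter_subset _ _))

/-- **Normalisation**: `∑_{U ⊆ F} q(F,U) = 1`. [folklore] -/
theorem sum_adsTraceLimitGen {β : ℝ} (hβ : 0 ≤ β) (F : Finset (Sym2 (Site d))) :
    ∑ U ∈ F.powerset, adsTraceLimitGen d β F U = 1 := by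
  have hL : ∀ L : ℕ, ∑ U ∈ F.powerset, (adsDoubleCurrentLaw d L β).real (localCylinder (↑F : Set (Sym2 (Site d))) ↑U) = 1 := by
    intro L
    haveI := isProbabilityMeasure_adsDoubleCurrentLaw d L hβ
    have h := measureReal_eq_sum_localCylinder d (adsDoubleCurrentLaw d L β) (A := Set.univ)
      (determinedBy_univ (↑F : Set (Sym2 (Site d))))
    rw [probReal_univ] at h
    simp only [Set.mem_univ, Finset.filter_true] at h
    exact h.symm
  have ht : Tendsto (fun L : ℕ => ∑ U ∈ F.powerset, (adsDoubleCurrentLaw d L β).real (localCylinder (↑F : Set (Sym2 (Site d))) ↑U))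
      atTop (𝓝 (∑ U ∈ F.powerset, adsTraceLimitGen d β F U)) :=
    tendsto_finsetSum _ fun U hU => tendsto_adsDoubleCurrentLaw_localCylinder d hβ (Finset.mem_powerset.1 hU)
  simp_rw [hL] at ht
  exact tendsto_nhds_unique ht tendsto_const_nhds

/-- A cylinder `[ω]_K` is determined by the coordinates in `K` (general index type). [folklore] -/
theorem determinedBy_localCylinder {ι : Type*} (K ω : Set ι) : DeterminedBy (localCylinder K ω) K := by
  rw [determinedBy_iff]
  intro ω₁ ω₂ h
  simp only [localCylinder, Set.mem_setOf_eq]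
  have key : ∀ e ∈ K, (e ∈ ω₁ ↔ e ∈ ω₂) := fun e he =>
    ⟨fun h₁ => ((Set.ext_iff.1 h e).1 ⟨h₁, he⟩).1, fun h₂ => ((Set.ext_iff.1 h e).2 ⟨h₂, he⟩).1⟩
  exact forall₂_congr fun e he => by rw [key e he]

/-- A finite set of pairs `U`, read as a configuration, lies in the cylinder of `U'` on `J`
(`U' ⊆ J`) iff `U ∩ J = U'`. [folklore] -/
theorem coe_mem_localCylinder_iff {J U U' : Finset (Sym2 (Site d))} (hU' : U' ⊆ J) :
    (↑U : Set (Sym2 (Site d))) ∈ localCylinder (↑J : Set (Sym2 (Site d))) ↑U' ↔ U ∩ J = U' := by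
  simp only [mem_localCylinder_coe_iff, Finset.mem_coe]
  constructor
  · intro h
    ext e
    rw [Finset.mem_inter]
    exact ⟨fun he => (h e he.2).2 he.1, fun he => ⟨(h e (hU' he)).1 he, hU' he⟩⟩
  · rintro rfl e he
    rw [Finset.mem_inter]
    exact ⟨fun h => h.1, fun h => ⟨h, he⟩⟩

/-- **Consistency**: for `J ⊆ I` and `U' ⊆ J`, the trace event on `J` is the disjoint union of the
cylinders on `I` restricting to it, so `q(J,U') = ∑_{U ⊆ I, U ∩ J = U'} q(I,U)`. [folklore] -/
theorem adsTraceLimitGen_eq_sum {β : ℝ} (hβ : 0 ≤ β) {I J : Finset (Sym2 (Site d))} (hJI : J ⊆ I)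
    {U' : Finset (Sym2 (Site d))} (hU' : U' ⊆ J) :
    adsTraceLimitGen d β J U' =
      ∑ U ∈ I.powerset.filter (fun U => U ∩ J = U'), adsTraceLimitGen d β I U := by
  classical
  have hfil : I.powerset.filter (fun U : Finset (Sym2 (Site d)) => (↑U : Set (Sym2 (Site d))) ∈ localCylinder (↑J : Set (Sym2 (Site d))) ↑U') =
      I.powerset.filter (fun U => U ∩ J = U') :=
    Finset.filter_congr fun U _ => coe_mem_localCylinder_iff d hU'
  -- the finite-volume identity and its limit
  have hL : ∀ L : ℕ, (adsDoubleCurrentLaw d L β).real (localCylinder (↑J : Set (Sym2 (Site d))) ↑U') =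
      ∑ U ∈ I.powerset.filter (fun U => U ∩ J = U'), (adsDoubleCurrentLaw d L β).real (localCylinder (↑I : Set (Sym2 (Site d))) ↑U) := by
    intro L
    haveI := isProbabilityMeasure_adsDoubleCurrentLaw d L hβ
    rw [← hfil]
    exact measureReal_eq_sum_localCylinder d _
      ((determinedBy_localCylinder _ _).mono (Finset.coe_subset.2 hJI))
  have h1 := tendsto_adsDoubleCurrentLaw_localCylinder d hβ hU'
  simp_rw [hL] at h1
  have h2 : Tendsto (fun L : ℕ => ∑ U ∈ I.powerset.filter (fun U => U ∩ J = U'),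
      (adsDoubleCurrentLaw d L β).real (localCylinder (↑I : Set (Sym2 (Site d))) ↑U)) atTop
      (𝓝 (∑ U ∈ I.powerset.filter (fun U => U ∩ J = U'), adsTraceLimitGen d β I U)) :=
    tendsto_finsetSum _ fun U hU =>
      tendsto_adsDoubleCurrentLaw_localCylinder d hβ (Finset.mem_powerset.1 (Finset.mem_of_mem_filter U hU))
  exact tendsto_nhds_unique h1 h2

/-! ### The projective family of finite-dimensional laws -/

/-- The indicator function `χ_U : J → Bool` of `U` on `J`. [folklore] -/
def bondCoordPoint (J U : Finset (Sym2 (Site d))) : J → Bool := fun j => decide (j.1 ∈ U)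

/-- `χ` is injective on the subsets of `J`. [folklore] -/
theorem bondCoordPoint_injective {J U U' : Finset (Sym2 (Site d))} (hU : U ⊆ J) (hU' : U' ⊆ J)
    (h : bondCoordPoint d J U = bondCoordPoint d J U') : U = U' := by
  ext e
  constructor
  · intro he
    have := congrFun h ⟨e, hU he⟩
    simp only [bondCoordPoint, decide_eq_decide] at this
    exact this.1 he
  · intro he
    have := congrFun h ⟨e, hU' he⟩
    simp only [bondCoordPoint, decide_eq_decide] at this
    exact this.2 he

/-- **The finite-dimensional laws of the infinite-volume double current**:
`P_J = ∑_{U ⊆ J} q(J,U) δ_{χ_U}` on `J → Bool` (the limit law of the bond variables `(𝟙[e open])_{e ∈ J}`). [cite: AizenmanDuminilCopinSidoraviciusCMP2015, Thm. 2.3 (R1), proof] -/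
def adsProjectiveFamily (β : ℝ) (J : Finset (Sym2 (Site d))) : Measure (J → Bool) :=
  ∑ U ∈ J.powerset, ENNReal.ofReal (adsTraceLimitGen d β J U) • Measure.dirac (bondCoordPoint d J U)

/-- The finite-dimensional laws evaluated on a set. [folklore] -/
theorem adsProjectiveFamily_apply (β : ℝ) (J : Finset (Sym2 (Site d))) (s : Set (J → Bool)) :
    adsProjectiveFamily d β J s =
      ∑ U ∈ J.powerset, ENNReal.ofReal (adsTraceLimitGen d β J U) * s.indicator 1 (bondCoordPoint d J U) := by
  rw [adsProjectiveFamily, Measure.finsetSum_apply]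
  refine Finset.sum_congr rfl fun U _ => ?_
  rw [Measure.smul_apply, Measure.dirac_apply, smul_eq_mul]

/-- The finite-dimensional laws are probability measures (`∑_U q(J,U) = 1`). [folklore] -/
theorem isProbabilityMeasure_adsProjectiveFamily {β : ℝ} (hβ : 0 ≤ β) (J : Finset (Sym2 (Site d))) :
    IsProbabilityMeasure (adsProjectiveFamily d β J) := by
  constructor
  rw [adsProjectiveFamily_apply]
  simp only [Set.indicator_univ, Pi.one_apply, mul_one]
  rw [← ENNReal.ofReal_sum_of_nonneg fun U hU => adsTraceLimitGen_nonneg d hβ (Finset.mem_powerset.1 hU),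
    sum_adsTraceLimitGen d hβ, ENNReal.ofReal_one]

/-- Restricting the indicator of `U ⊆ I` to `J ⊆ I` gives the indicator of `U ∩ J`. [folklore] -/
theorem restrict₂_bondCoordPoint {I J : Finset (Sym2 (Site d))} (hJI : J ⊆ I) (U : Finset (Sym2 (Site d))) :
    Finset.restrict₂ (π := fun _ : Sym2 (Site d) => Bool) hJI (bondCoordPoint d I U) = bondCoordPoint d J (U ∩ J) := by
  funext j
  simp only [Finset.restrict₂, bondCoordPoint, Finset.mem_inter, decide_eq_decide]
  exact ⟨fun h => ⟨h, j.2⟩, fun h => h.1⟩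

/-- **The finite-dimensional laws form a projective family** (consistency under restriction,
`adsTraceLimitGen_eq_sum`). [cite: AizenmanDuminilCopinSidoraviciusCMP2015, Thm. 2.3 (R1), proof] -/
theorem isProjectiveMeasureFamily_adsProjectiveFamily {β : ℝ} (hβ : 0 ≤ β) :
    IsProjectiveMeasureFamily (α := fun _ : Sym2 (Site d) => Bool) (adsProjectiveFamily d β) := by
  classical
  intro I J hJI
  ext s hs
  rw [Measure.map_apply (Finset.measurable_restrict₂ hJI) hs, adsProjectiveFamily_apply,
    adsProjectiveFamily_apply]
  have hind : ∀ U, (Finset.restrict₂ (π := fun _ : Sym2 (Site d) => Bool) hJI ⁻¹' s).indicator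
      (1 : (I → Bool) → ℝ≥0∞) (bondCoordPoint d I U) = s.indicator 1 (bondCoordPoint d J (U ∩ J)) := by
    intro U
    simp only [Set.indicator_apply, Set.mem_preimage, restrict₂_bondCoordPoint d hJI, Pi.one_apply]
  simp_rw [hind]
  rw [← Finset.sum_fiberwise_of_maps_to (s := I.powerset) (t := J.powerset) (g := fun U => U ∩ J)
    (fun U _ => Finset.mem_powerset.2 Finset.inter_subset_right)]
  refine Finset.sum_congr rfl fun U' hU' => ?_
  rw [adsTraceLimitGen_eq_sum d hβ hJI (Finset.mem_powerset.1 hU'),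
    ENNReal.ofReal_sum_of_nonneg fun U hU =>
      adsTraceLimitGen_nonneg d hβ (Finset.mem_powerset.1 (Finset.mem_of_mem_filter U hU)),
    Finset.sum_mul]
  refine Finset.sum_congr rfl fun U hU => ?_
  rw [(Finset.mem_filter.1 hU).2]

/-! ### The Kolmogorov extension and its transport to bond configurations -/

/-- Reading a `Bool`-valued bond function as a bond configuration. [folklore] -/
def boolToBondConfig (f : Sym2 (Site d) → Bool) : BondConfig (Site d) := {e | f e = true}

/-- `boolToBondConfig` is measurable (each coordinate event is a coordinate preimage). [folklore] -/
theorem measurable_boolToBondConfig : Measurable (boolToBondConfig d) := by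
  refine measurable_set_iff.2 fun e => ?_
  refine measurable_to_prop ?_
  have : (fun f : Sym2 (Site d) → Bool => e ∈ boolToBondConfig d f) ⁻¹' {True} =
      (fun f : Sym2 (Site d) → Bool => f e) ⁻¹' {true} := by
    ext f
    simp [boolToBondConfig]
  rw [this]
  exact (measurable_pi_apply e) (measurableSet_singleton true)

/-- The cylinders pull back to the fibres of the finite restrictions. [folklore] -/
theorem preimage_boolToBondConfig_localCylinder (F U : Finset (Sym2 (Site d))) :
    boolToBondConfig d ⁻¹' localCylinder (↑F : Set (Sym2 (Site d))) ↑U =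
      Finset.restrict (π := fun _ : Sym2 (Site d) => Bool) F ⁻¹' {bondCoordPoint d F U} := by
  ext f
  rw [Set.mem_preimage, Set.mem_preimage, Set.mem_singleton_iff, mem_localCylinder_coe_iff]
  change (∀ e ∈ F, (e ∈ U ↔ f e = true)) ↔ _
  constructor
  · intro h
    funext j
    change f j.1 = decide (j.1 ∈ U)
    by_cases hj : j.1 ∈ U
    · rw [decide_eq_true hj]
      exact (h j.1 j.2).1 hj
    · rw [decide_eq_false hj, Bool.eq_false_iff]
      exact fun ht => hj ((h j.1 j.2).2 ht)
  · intro h e he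
    have hj := congrFun h ⟨e, he⟩
    change f e = decide (e ∈ U) at hj
    rw [hj, decide_eq_true_iff]

/-- **Existence of the infinite-volume double current** (`β ≥ 0`): the Kolmogorov extension of the
projective family `adsProjectiveFamily d β` (the tree's `Literature.Probability.Process.exists_isProjectiveLimit_holds`; `Bool`
is Polish), transported to bond configurations, is an `IsAdsLimit d β` measure — every local event
is a finite disjoint union of cylinders, on which both the finite-volume laws (in the limit) and
the extension are given by `q(F,U)`. [cite: AizenmanDuminilCopinSidoraviciusCMP2015, Thm. 2.3 (R1) and §2.3] -/
theorem exists_isAdsLimit {β : ℝ} (hβ : 0 ≤ β) : ∃ μ, IsAdsLimit d β μ := by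
  classical
  have hP := isProjectiveMeasureFamily_adsProjectiveFamily d hβ
  haveI : ∀ J, IsProbabilityMeasure (adsProjectiveFamily d β J) := fun J =>
    isProbabilityMeasure_adsProjectiveFamily d hβ J
  haveI : ∀ i : Sym2 (Site d), PolishSpace ((fun _ : Sym2 (Site d) => Bool) i) := fun _ =>
    inferInstanceAs (PolishSpace Bool)
  haveI : ∀ i : Sym2 (Site d), BorelSpace ((fun _ : Sym2 (Site d) => Bool) i) := fun _ =>
    inferInstanceAs (BorelSpace Bool)
  obtain ⟨ν, hν⟩ := Literature.Probability.Process.exists_isProjectiveLimit_holds (α := fun _ : Sym2 (Site d) => Bool) hP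
  haveI := hν.isProbabilityMeasure
  set μ : Measure (BondConfig (Site d)) := ν.map (boolToBondConfig d) with hμ
  haveI : IsProbabilityMeasure μ := Measure.isProbabilityMeasure_map (measurable_boolToBondConfig d).aemeasurable
  -- `μ` charges the cylinders with `q(F,U)`
  have hμU : ∀ {F U : Finset (Sym2 (Site d))}, U ⊆ F →
      μ.real (localCylinder (↑F : Set (Sym2 (Site d))) ↑U) = adsTraceLimitGen d β F U := by
    intro F U hU
    rw [measureReal_def, hμ, Measure.map_apply (measurable_boolToBondConfig d) (measurableSet_localCylinder_coe d F ↑U),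
      preimage_boolToBondConfig_localCylinder,
      ← Measure.map_apply (Finset.measurable_restrict (X := fun _ : Sym2 (Site d) => Bool) F)
        (measurableSet_singleton _), hν F, adsProjectiveFamily_apply]
    rw [Finset.sum_eq_single_of_mem U (Finset.mem_powerset.2 hU) fun U' hU' hne => by
      rw [Set.indicator_of_notMem, mul_zero]
      rw [Set.mem_singleton_iff]
      exact fun h => hne (bondCoordPoint_injective d (Finset.mem_powerset.1 hU') hU h)]
    rw [Set.indicator_of_mem (Set.mem_singleton _), Pi.one_apply, mul_one,
      ENNReal.toReal_ofReal (adsTraceLimitGen_nonneg d hβ hU)]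
  refine ⟨μ, ⟨inferInstance, ?_⟩⟩
  rintro A ⟨F, hF⟩
  rw [measureReal_eq_sum_localCylinder d μ hF]
  have hLsum : ∀ L : ℕ, (adsDoubleCurrentLaw d L β).real A =
      ∑ U ∈ F.powerset.filter (fun U : Finset (Sym2 (Site d)) => (↑U : Set (Sym2 (Site d))) ∈ A),
        (adsDoubleCurrentLaw d L β).real (localCylinder (↑F : Set (Sym2 (Site d))) ↑U) := by
    intro L
    haveI := isProbabilityMeasure_adsDoubleCurrentLaw d L hβ
    exact measureReal_eq_sum_localCylinder d _ hF
  simp_rw [hLsum]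
  have hlim : ∑ U ∈ F.powerset.filter (fun U : Finset (Sym2 (Site d)) => (↑U : Set (Sym2 (Site d))) ∈ A), μ.real (localCylinder (↑F : Set (Sym2 (Site d))) ↑U) =
      ∑ U ∈ F.powerset.filter (fun U : Finset (Sym2 (Site d)) => (↑U : Set (Sym2 (Site d))) ∈ A), adsTraceLimitGen d β F U :=
    Finset.sum_congr rfl fun U hU => hμU (Finset.mem_powerset.1 (Finset.mem_of_mem_filter U hU))
  rw [hlim]
  exact tendsto_finsetSum _ fun U hU =>
    tendsto_adsDoubleCurrentLaw_localCylinder d hβ (Finset.mem_powerset.1 (Finset.mem_of_mem_filter U hU))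

end Literature.Probability.LatticeModels

namespace Literature.Probability.LatticeModels

open Percolation

variable {d : ℕ}

/-- **ADS15 Thm. 2.3 (R1) for the double current, proved** (Aizenman–Duminil-Copin–Sidoravicius,
CMP 334 (2015), Thm. 2.3 and its proof, §2.3): discharge of the named fact
`ads_doubleCurrent_limit_exists` of `DoubleCurrentsInfinite.lean` — for `β > 0` (indeed `β ≥ 0`)
the box double currents `ℙ_{Λ_L,β}` converge on every local event to a probability measure. [cite: AizenmanDuminilCopinSidoraviciusCMP2015, Thm. 2.3 (R1) and §2.3] -/
theorem ads_doubleCurrent_limit_exists_holds : ads_doubleCurrent_limit_exists (d := d) :=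
  fun _ hβ => exists_isAdsLimit d hβ.le

end Literature.Probability.LatticeModels
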